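import Summits.BirchSwinnertonDyer.BirchSwinnertonDyer.Theorems.AlignedTransportAtTwoMainConjectureTransportAlignedAtTwoDeltaPosJacobian
import HarnessLib

/-!
# Crux C1 `MainConjectureTransportAlignedAtTwo` (stmt-BirchSwinnertonDyer-22296), line `birth`, residual (R2) `stub_lamLawKilford` (Kilford stratum):
# SAME COPY ⟹ TRANSPORT — two parametrisations at one level whose Jacobi maps have the SAME KERNEL on `J₀(N)[2]` transport half-classes
# `[x/2]` to `2`-torsion points that differ by THE equivariant isomorphism of the shared cubic field (width seat att-p3 g15; `--supports 22296`)

THEOREMS ONLY (no `def`, no `sorry`, no named fact). CONDITIONAL on a carrier instance `J : ModularJacobianGaloisData N ι` (hypothesis; typing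
ask T1) and on the SAME-KERNEL hypothesis `hker`. BSD is not proved by this; C1 is not closed by this; `stub_lamLawKilford` is NOT discharged by this.

WHY. The lead's (G1c) `…DeltaPosJacobian.jacobiMap_half_transport` (p667761) needs the common kernel `K = ker θ₁ ⊓ ker θ₂ ⊆ Λ = H₁(X₀(N);ℤ)` of the
two maps `θᵢ : Λ → Wᵢ[2]`, `x ↦ (the P with ι P = Dᵢ.jacobiMap [x/2])`, to have at most FOUR cosets; OFF the Kilford stratum this is Buzzard's mod-`2`
multiplicity one + Hecke self-duality (`…DeltaPosFourCosets`). ON the stratum (`Δ(W) ∈ ℚ₂²`, `ρ̄|_{D₂}` trivial) multiplicity one FAILS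
(Kilford–Wiese 2008): `J₀(N)[𝔪] ≅ ρ̄ ⊕ ρ̄` and the two curves' `2`-torsion occupy two of the THREE copies of `ρ̄` — the same copy or not. The cell's
IMC lens isolated the replacement input (MEMO-imc §10.24 «H12♯», typed in the tree as `F1Sign2.CopyAlignmentAtTwo` + `F1Sign2.MultiplicityTwoOnStratumAtTwo`,
REF1 §34; census H12 10/10, P14, SYMTEST9 2 596/2 596): at multiplicity two, ALIGNED AT `2` ⟺ the two curves occupy the SAME COPY. Read through the
parametrisations (`ker πᵢ ∩ J[2] = (copyᵢ)^⊥` for the Weil pairing) «same copy» is «same kernel of the two Jacobi maps on `J₀(N)[2]`», which is the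
hypothesis `hker` of this file. With it the four-coset bound is FREE (the common kernel IS `ker θ₁`, of index `#W₁[2] = 4` by surjectivity), so:

* §1 **`jacobiMap_half_transport_of_ker_iff`** — `J : ModularJacobianGaloisData N ι`; data `D₁ D₂` at ONE level `N` for `W₁ W₂` (no rational `2`-torsion
  abscissa, `Δ(W₂) ∉ ℚ²`, a shared cubic field); `hnz₁` (`θ₁ ≠ 0`, from the `μ = 0` theorem downstream); `hker`. THEN for `x ∈ Λ` and `P₁ ∈ W₁[2](ℚ̄)` with
  `D₁.jacobiMap [x/2] = ι P₁`: `D₂.jacobiMap [x/2] = ι (e P₁)`, `e` THE equivariant iso. NO Hecke-side PRINT (`hSD`, `hBz`), NO stratum hypothesis, NO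
  parity of levels, NO `a_q`-congruence hypothesis — valid on and off the stratum.
* §2 `jacobiMap_half_link_of_ker_iff` — the same in the «link» currency consumed by att-p3 g14's `…DeltaPosParityLink.even_plusValue_iff_of_link`;
  `ker_iff_symm` — bookkeeping.

What remains for (R2) at equal conductors after this file: the capstones (Δ > 0: `…DeltaPosCongruence` with this transport; Δ < 0: the rhombic (K2⁻)
dictionary) — sibling files of this seat — and the genuinely open input «`AlignedAtTwo` ⟹ `hker`» (= `CopyAlignmentAtTwo` at multiplicity two).

References: Darmon–Diamond–Taylor 1995 §1.5, §1.7 [DarmonDiamondTaylor1995]; Kilford–Wiese 2008 Thm. 1.1, Question 1.9 [KilfordWiese2008];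
Wiese 2007 Prop. 2.2, Cor. 4.2 [Wiese2007Multiplicities]; Silverman AEC III.§7 [SilvermanAEC2009].
-/

noncomputable section

-- justification: the `Summit.BirchSwinnertonDyer.BirchSwinnertonDyer.…` path repeats a component (route-file convention)
set_option linter.dupNamespace false
set_option autoImplicit false

open scoped MatrixGroups ModularForm NumberField Classical
open CongruenceSubgroup Complex WeierstrassCurve IsDedekindDomain Polynomial Module
open Literature.NumberTheory.EllipticCurves Literature.NumberTheory.EllipticCurves.ModularForms
open Literature.NumberTheory.EllipticCurves.Greenberg1999
open Summit.BirchSwinnertonDyer.Rank1Residual.F1Sign2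
open Summit.BirchSwinnertonDyer.BirchSwinnertonDyer.Theorems.AlignedTransportAtTwoDeltaPosGaloisPlane
open Summit.BirchSwinnertonDyer.BirchSwinnertonDyer.Theorems.AlignedTransportAtTwoDeltaPosJacobian

namespace Summit.BirchSwinnertonDyer.BirchSwinnertonDyer.Theorems.AlignedTransportAtTwoKilfordCopyTransport

variable {N : ℕ} [NeZero N]

/-! ## §1 The transport theorem under the same-kernel hypothesis -/

/-- **SAME COPY ⟹ TRANSPORT.** With the `ℚ`-structure carrier `J`, two parametrisation data `D₁ D₂` at ONE level `N` of curves `W₁ W₂` without rational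
`2`-torsion abscissa, `Δ(W₂) ∉ ℚ²`, sharing a cubic field `F ∋ r₁, r₂`; `D₁.jacobiMap` non-zero on some half-class; and the two Jacobi maps having
the SAME KERNEL on the half-classes `[x/2]`, `x ∈ Λ` («the two curves occupy the same copy of `ρ̄` in `J₀(N)[2]`»): for every `x ∈ Λ` and
`P₁ ∈ W₁[2](ℚ̄)` with `D₁.jacobiMap [x/2] = ι P₁` one has `D₂.jacobiMap [x/2] = ι (e P₁)`, `e` THE `Γ_ℚ`-equivariant isomorphism of the shared
cubic field. Valid ON the Kilford stratum (no multiplicity one is used). [cite: DarmonDiamondTaylor1995, §1.5 and §1.7]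
[cite: KilfordWiese2008, Thm. 1.1 and Question 1.9] -/
theorem jacobiMap_half_transport_of_ker_iff (ι : AlgebraicClosure ℚ →+* ℂ) (J : ModularJacobianGaloisData N ι)
    {W₁ W₂ : WeierstrassCurve ℚ} [W₁.IsElliptic] [W₂.IsElliptic]
    (D₁ : ModularParametrizationData W₁ N) (D₂ : ModularParametrizationData W₂ N)
    (ht₁ : ∀ x : ℚ, ¬ HasRationalTwoTorsionX W₁ x) (ht₂ : ∀ x : ℚ, ¬ HasRationalTwoTorsionX W₂ x) (hΔ₂ : ¬ IsSquare W₂.Δ)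
    {F : Type*} [Field F] [Algebra ℚ F] [FiniteDimensional ℚ F] (hF : finrank ℚ F = 3)
    {r₁ r₂ : F} (hr₁ : aeval r₁ (twoDivisionUCubic W₁) = 0) (hr₂ : aeval r₂ (twoDivisionUCubic W₂) = 0)
    (hnz₁ : ∃ x ∈ periodHomology N, D₁.jacobiMap (Submodule.Quotient.mk ((2 : ℂ)⁻¹ • x)) ≠ 0)
    (hker : ∀ x ∈ periodHomology N,
      D₁.jacobiMap (Submodule.Quotient.mk ((2 : ℂ)⁻¹ • x)) = 0 ↔ D₂.jacobiMap (Submodule.Quotient.mk ((2 : ℂ)⁻¹ • x)) = 0)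
    (e : geomTorsion W₁ (2 : ℤ) ≃+ geomTorsion W₂ (2 : ℤ))
    (he : ∀ (σ : Field.absoluteGaloisGroup ℚ) (P : geomTorsion W₁ (2 : ℤ)), e (σ • P) = σ • e P)
    {x : Module.Dual ℂ (CuspForm (Gamma0 N) 2)} (hx : x ∈ periodHomology N) {P₁ : geomTorsion W₁ (2 : ℤ)}
    (hP₁ : D₁.jacobiMap (Submodule.Quotient.mk ((2 : ℂ)⁻¹ • x)) = W₁.geomPointsToComplex ι (P₁ : W₁.geomPoints)) :
    D₂.jacobiMap (Submodule.Quotient.mk ((2 : ℂ)⁻¹ • x)) = W₂.geomPointsToComplex ι ((e P₁ : geomTorsion W₂ (2 : ℤ)) : W₂.geomPoints) := by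
  -- notation
  set Λ := periodHomology N with hΛ
  let half : Module.Dual ℂ (CuspForm (Gamma0 N) 2) → J0 N := fun z ↦ Submodule.Quotient.mk ((2 : ℂ)⁻¹ • z)
  have half_add : ∀ z z', half (z + z') = half z + half z' := fun z z' ↦ by
    simp only [half, smul_add, Submodule.Quotient.mk_add]
  -- the maps `θᵢ : Λ → Wᵢ[2]` through `existsUnique_geomTorsion_eq`
  have hex₁ : ∀ z : Λ, ∃! P : geomTorsion W₁ (2 : ℤ), W₁.geomPointsToComplex ι (P : W₁.geomPoints) = D₁.jacobiMap (half z) :=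
    fun z ↦ existsUnique_geomTorsion_eq W₁ ι (jacobiMap_half_add_self D₁ z.2)
  have hex₂ : ∀ z : Λ, ∃! P : geomTorsion W₂ (2 : ℤ), W₂.geomPointsToComplex ι (P : W₂.geomPoints) = D₂.jacobiMap (half z) :=
    fun z ↦ existsUnique_geomTorsion_eq W₂ ι (jacobiMap_half_add_self D₂ z.2)
  choose θ₁f hθ₁f using fun z ↦ (hex₁ z).exists
  choose θ₂f hθ₂f using fun z ↦ (hex₂ z).exists
  have uniq₁ : ∀ (z : Λ) (P : geomTorsion W₁ (2 : ℤ)), W₁.geomPointsToComplex ι (P : W₁.geomPoints) = D₁.jacobiMap (half z) → P = θ₁f z :=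
    fun z P hP ↦ (hex₁ z).unique hP (hθ₁f z)
  have uniq₂ : ∀ (z : Λ) (P : geomTorsion W₂ (2 : ℤ)), W₂.geomPointsToComplex ι (P : W₂.geomPoints) = D₂.jacobiMap (half z) → P = θ₂f z :=
    fun z P hP ↦ (hex₂ z).unique hP (hθ₂f z)
  let θ₁ : Λ →+ geomTorsion W₁ (2 : ℤ) :=
    { toFun := θ₁f
      map_zero' := by
        symm; apply uniq₁
        have h0 : half 0 = 0 := by simp only [half, smul_zero, Submodule.Quotient.mk_zero]
        rw [ZeroMemClass.coe_zero, map_zero, ZeroMemClass.coe_zero, h0, map_zero]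
      map_add' := fun z z' ↦ by
        symm; apply uniq₁
        rw [AddSubgroup.coe_add, map_add, hθ₁f, hθ₁f, AddSubgroup.coe_add, half_add, map_add] }
  let θ₂ : Λ →+ geomTorsion W₂ (2 : ℤ) :=
    { toFun := θ₂f
      map_zero' := by
        symm; apply uniq₂
        have h0 : half 0 = 0 := by simp only [half, smul_zero, Submodule.Quotient.mk_zero]
        rw [ZeroMemClass.coe_zero, map_zero, ZeroMemClass.coe_zero, h0, map_zero]
      map_add' := fun z z' ↦ by
        symm; apply uniq₂
        rw [AddSubgroup.coe_add, map_add, hθ₂f, hθ₂f, AddSubgroup.coe_add, half_add, map_add] }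
  have hθ₁_apply : ∀ z, θ₁ z = θ₁f z := fun _ ↦ rfl
  have hθ₂_apply : ∀ z, θ₂ z = θ₂f z := fun _ ↦ rfl
  -- kernels in `jacobiMap` currency
  have hker₁ : ∀ z : Λ, θ₁ z = 0 ↔ D₁.jacobiMap (half z) = 0 := by
    intro z
    constructor
    · intro h
      have := hθ₁f z
      rw [← hθ₁_apply, h, ZeroMemClass.coe_zero, map_zero] at this
      exact this.symm
    · intro h
      rw [hθ₁_apply]; symm; apply uniq₁
      rw [ZeroMemClass.coe_zero, map_zero]; exact h.symm
  have hker₂ : ∀ z : Λ, θ₂ z = 0 ↔ D₂.jacobiMap (half z) = 0 := by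
    intro z
    constructor
    · intro h
      have := hθ₂f z
      rw [← hθ₂_apply, h, ZeroMemClass.coe_zero, map_zero] at this
      exact this.symm
    · intro h
      rw [hθ₂_apply]; symm; apply uniq₂
      rw [ZeroMemClass.coe_zero, map_zero]; exact h.symm
  have hkk : ∀ z : Λ, θ₁ z = 0 ↔ θ₂ z = 0 := fun z ↦ by
    rw [hker₁, hker₂]; exact hker z z.2
  -- the torsion points `⟨half z⟩ ∈ J0.tors N` and the lifted Galois action on `Λ`
  have htors : ∀ z : Λ, half z ∈ J0.tors N := fun z ↦ by
    rw [J0.mem_tors_iff, isOfFinAddOrder_iff_nsmul_eq_zero]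
    exact ⟨2, two_pos, by rw [two_nsmul]; exact half_add_half_eq_zero z.2⟩
  have hlift : ∀ (σ : Field.absoluteGaloisGroup ℚ) (z : Λ), ∃ z' : Λ,
      half z' = ((J.galAct σ ⟨half z, htors z⟩ : J0.tors N) : J0 N) := by
    intro σ z
    set t : J0.tors N := J.galAct σ ⟨half z, htors z⟩ with ht
    have htt : (t : J0 N) + (t : J0 N) = 0 := by
      rw [← Submodule.coe_add, ht, ← map_add]
      have : (⟨half z, htors z⟩ : J0.tors N) + ⟨half z, htors z⟩ = 0 := Subtype.ext (half_add_half_eq_zero z.2)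
      rw [this, map_zero, Submodule.coe_zero]
    obtain ⟨z', hz', hz'eq⟩ := exists_half_eq htt
    exact ⟨⟨z', hz'⟩, hz'eq⟩
  choose act hact using hlift
  -- equivariance
  have hθ₁ : ∀ (σ : Field.absoluteGaloisGroup ℚ) (z : Λ), θ₁ (act σ z) = σ • θ₁ z := by
    intro σ z
    symm
    rw [hθ₁_apply, hθ₁_apply]
    apply uniq₁
    rw [AddSubgroup.torsionBy.coe_smul, hact σ z]
    exact (J.jacobiMap_galAct W₁ D₁ σ ⟨half z, htors z⟩ (θ₁f z : W₁.geomPoints) (hθ₁f z).symm).symm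
  have hθ₂ : ∀ (σ : Field.absoluteGaloisGroup ℚ) (z : Λ), θ₂ (act σ z) = σ • θ₂ z := by
    intro σ z
    symm
    rw [hθ₂_apply, hθ₂_apply]
    apply uniq₂
    rw [AddSubgroup.torsionBy.coe_smul, hact σ z]
    exact (J.jacobiMap_galAct W₂ D₂ σ ⟨half z, htors z⟩ (θ₂f z : W₂.geomPoints) (hθ₂f z).symm).symm
  -- non-vanishing of `θ₁`, and of `θ₂` through the same kernel
  have h0₁ : ∃ z, θ₁ z ≠ 0 := by
    obtain ⟨z, hz, hne⟩ := hnz₁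
    exact ⟨⟨z, hz⟩, fun h0 ↦ hne ((hker₁ ⟨z, hz⟩).mp h0)⟩
  have h0₂ : ∃ z, θ₂ z ≠ 0 := by
    obtain ⟨z, hz⟩ := h0₁
    exact ⟨z, fun h0 ↦ hz ((hkk z).mpr h0)⟩
  -- the common kernel IS `ker θ₁`, of index `4` by surjectivity onto `W₁[2]`
  set K : AddSubgroup Λ := θ₁.ker with hK
  have hK₁ : K ≤ θ₁.ker := le_rfl
  have hK₂ : K ≤ θ₂.ker := fun z hz ↦ by
    rw [AddMonoidHom.mem_ker] at hz ⊢
    exact (hkk z).mp hz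
  have hsurj₁ := surjective_of_equivariant_of_exists_ne_zero ht₁ act θ₁ hθ₁ h0₁
  have hidx : K.index = 4 := by
    rw [hK, AddSubgroup.index_ker, AddMonoidHom.range_eq_top.mpr hsurj₁, AddSubgroup.card_top]
    exact WeierstrassCurve.natCard_geomTorsion_two W₁
  -- the factorisation through THE equivariant isomorphism
  have hcomp := comp_eq_of_sharedCubicField (W₁ := W₁) (W₂ := W₂) hF ht₁ ht₂ hΔ₂ hr₁ hr₂ act θ₁ θ₂ hθ₁ hθ₂ h0₁ h0₂
    K hK₁ hK₂ (by rw [hidx]; norm_num) (by rw [hidx]) e he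
  -- conclude at `x`
  have hP₁' : P₁ = θ₁f ⟨x, hx⟩ := uniq₁ ⟨x, hx⟩ P₁ hP₁.symm
  have := hθ₂f ⟨x, hx⟩
  rw [← hθ₂_apply, hcomp ⟨x, hx⟩, hθ₁_apply, ← hP₁'] at this
  exact this.symm

/-! ## §2 Bookkeeping: the link currency and symmetry -/

/-- The same-kernel hypothesis is symmetric in the two data. [folklore] -/
theorem ker_iff_symm {W₁ W₂ : WeierstrassCurve ℚ}
    (D₁ : ModularParametrizationData W₁ N) (D₂ : ModularParametrizationData W₂ N)
    (hker : ∀ x ∈ periodHomology N,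
      D₁.jacobiMap (Submodule.Quotient.mk ((2 : ℂ)⁻¹ • x)) = 0 ↔ D₂.jacobiMap (Submodule.Quotient.mk ((2 : ℂ)⁻¹ • x)) = 0) :
    ∀ x ∈ periodHomology N,
      D₂.jacobiMap (Submodule.Quotient.mk ((2 : ℂ)⁻¹ • x)) = 0 ↔ D₁.jacobiMap (Submodule.Quotient.mk ((2 : ℂ)⁻¹ • x)) = 0 :=
  fun x hx ↦ (hker x hx).symm

/-- Under the same-kernel hypothesis, non-vanishing of one Jacobi map on a half-class is non-vanishing of the other. [folklore] -/
theorem exists_jacobiMap_half_ne_zero_of_ker_iff {W₁ W₂ : WeierstrassCurve ℚ}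
    (D₁ : ModularParametrizationData W₁ N) (D₂ : ModularParametrizationData W₂ N)
    (hker : ∀ x ∈ periodHomology N,
      D₁.jacobiMap (Submodule.Quotient.mk ((2 : ℂ)⁻¹ • x)) = 0 ↔ D₂.jacobiMap (Submodule.Quotient.mk ((2 : ℂ)⁻¹ • x)) = 0)
    (hnz₁ : ∃ x ∈ periodHomology N, D₁.jacobiMap (Submodule.Quotient.mk ((2 : ℂ)⁻¹ • x)) ≠ 0) :
    ∃ x ∈ periodHomology N, D₂.jacobiMap (Submodule.Quotient.mk ((2 : ℂ)⁻¹ • x)) ≠ 0 := by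
  obtain ⟨x, hx, hne⟩ := hnz₁
  exact ⟨x, hx, fun h ↦ hne ((hker x hx).mpr h)⟩

/-- **The link currency.** Under the hypotheses of §1, every cycle `x ∈ Λ` admits a point `P ∈ W₁[2](ℚ̄)` with `ι P = u_{W₁}(c₁·x(f₁)/2)` and
`ι (e P) = u_{W₂}(c₂·x(f₂)/2)` — the hypothesis `hlink` of att-p3 g14's `…DeltaPosParityLink.even_plusValue_iff_of_link`. [folklore] -/
theorem jacobiMap_half_link_of_ker_iff (ι : AlgebraicClosure ℚ →+* ℂ) (J : ModularJacobianGaloisData N ι)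
    {W₁ W₂ : WeierstrassCurve ℚ} [W₁.IsElliptic] [W₂.IsElliptic]
    (D₁ : ModularParametrizationData W₁ N) (D₂ : ModularParametrizationData W₂ N)
    (ht₁ : ∀ x : ℚ, ¬ HasRationalTwoTorsionX W₁ x) (ht₂ : ∀ x : ℚ, ¬ HasRationalTwoTorsionX W₂ x) (hΔ₂ : ¬ IsSquare W₂.Δ)
    {F : Type*} [Field F] [Algebra ℚ F] [FiniteDimensional ℚ F] (hF : finrank ℚ F = 3)
    {r₁ r₂ : F} (hr₁ : aeval r₁ (twoDivisionUCubic W₁) = 0) (hr₂ : aeval r₂ (twoDivisionUCubic W₂) = 0)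
    (hnz₁ : ∃ x ∈ periodHomology N, D₁.jacobiMap (Submodule.Quotient.mk ((2 : ℂ)⁻¹ • x)) ≠ 0)
    (hker : ∀ x ∈ periodHomology N,
      D₁.jacobiMap (Submodule.Quotient.mk ((2 : ℂ)⁻¹ • x)) = 0 ↔ D₂.jacobiMap (Submodule.Quotient.mk ((2 : ℂ)⁻¹ • x)) = 0)
    (e : geomTorsion W₁ (2 : ℤ) ≃+ geomTorsion W₂ (2 : ℤ))
    (he : ∀ (σ : Field.absoluteGaloisGroup ℚ) (P : geomTorsion W₁ (2 : ℤ)), e (σ • P) = σ • e P)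
    {x : Module.Dual ℂ (CuspForm (Gamma0 N) 2)} (hx : x ∈ periodHomology N) :
    ∃ P : geomTorsion W₁ (2 : ℤ),
      W₁.geomPointsToComplex ι (P : geomPoints W₁) = D₁.uniformize ((D₁.c : ℂ) * x D₁.f / 2) ∧
      W₂.geomPointsToComplex ι (e P : geomPoints W₂) = D₂.uniformize ((D₂.c : ℂ) * x D₂.f / 2) := by
  obtain ⟨P₁, hP₁, -⟩ := existsUnique_geomTorsion_eq W₁ ι (jacobiMap_half_add_self D₁ hx)
  have hP₂ := jacobiMap_half_transport_of_ker_iff ι J D₁ D₂ ht₁ ht₂ hΔ₂ hF hr₁ hr₂ hnz₁ hker e he hx hP₁.symm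
  exact ⟨P₁, by rw [hP₁, jacobiMap_half_eq], by rw [← hP₂, jacobiMap_half_eq]⟩

end Summit.BirchSwinnertonDyer.BirchSwinnertonDyer.Theorems.AlignedTransportAtTwoKilfordCopyTransport

end
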